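import Summits.AtomisticToContinuum.Crystallization.Theorems.FreeSplittingCertificatesStrictSplittingRuleFarMollifyAffine

/-!
# `StrictSplittingRule` (stmt-AtomisticToContinuum-12560): mollification of LIPSCHITZ, LOCALLY AFFINE fields (second brick of the density route)

Route `FreeSplittingCertificates`, crux r3 `StrictSplittingRule` (H12⋆ = `stub_coreJointCoercive`), unit b2b-freesplit-B gen 12.
VALUE = calculus bricks for HOME FAR-LEMMA-SPEC §10 (e) — NOT a proof of H12⋆, NOT summit progress.

The far theorem `farPencil_weighted_integral_le_of_affineTail` needs a `C²` field; the lattice→continuum transfer hands over the continuous piecewise-affine (P1)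
interpolant `ṽ` of a lattice displacement, which is Lipschitz and, off the (null) union of element faces, locally affine.  The density route mollifies:
`ṽ_δ = φ̃_δ ⋆ ṽ`.  This file supplies what the dominated-convergence step consumes:
* `normed_convolution_smooth`: `φ̃ ⋆ v` is `C²` for continuous `v`;
* `lipschitzWith_normed_convolution`: `φ̃ ⋆ v` is `K`-Lipschitz when `v` is (so `‖∇(φ̃ ⋆ v)‖ ≤ K` uniformly in `δ`);
* `dist_normed_convolution_self_le`: `dist ((φ̃ ⋆ v) x) (v x) ≤ K·rOut`;
* `normed_convolution_eq_self_of_affine_near` / `normed_convolution_eventuallyEq_of_affine_near` / `fderiv_normed_convolution_eq_of_affine_near`: where `v` is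
  affine on a ball of radius `> rOut`, the mollified field COINCIDES with `v` near the centre, hence has the same value and the same derivative there — so along
  `δ → 0` the integrands of the far ledger are eventually constant at every point off the faces.
-/

noncomputable section

open MeasureTheory Topology Filter ContinuousLinearMap Metric
open scoped Convolution NNReal

namespace Summit.AtomisticToContinuum.Crystallization.Theorems.StrictSplittingRuleBirth

variable {F : Type*} [NormedAddCommGroup F] [NormedSpace ℝ F] [CompleteSpace F]

omit [CompleteSpace F] in
/-- The mollification `φ̃ ⋆ v` of a continuous field by a normed bump is `C²` (any finite order; `2` is what the far theorem wants). -/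
theorem normed_convolution_smooth (φ : ContDiffBump (0 : Fin 3 → ℝ)) {v : (Fin 3 → ℝ) → F} (hv : Continuous v) :
    ContDiff ℝ 2 (φ.normed volume ⋆[lsmul ℝ ℝ, volume] v) :=
  φ.hasCompactSupport_normed.contDiff_convolution_left _ φ.contDiff_normed (hv.locallyIntegrable (μ := volume))

omit [CompleteSpace F] in
/-- The integrand `t ↦ φ̃(t) • v(x − t)` of the mollification is integrable (continuous with compact support). -/
theorem integrable_normed_smul_comp_sub (φ : ContDiffBump (0 : Fin 3 → ℝ)) {v : (Fin 3 → ℝ) → F} (hv : Continuous v)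
    (x : Fin 3 → ℝ) : Integrable (fun t => φ.normed volume t • v (x - t)) :=
  (φ.continuous_normed.smul (hv.comp (continuous_const.sub continuous_id))).integrable_of_hasCompactSupport
    (φ.hasCompactSupport_normed.smul_right)

omit [CompleteSpace F] in
/-- **Mollification does not increase the Lipschitz constant**: `φ̃ ⋆ v` is `K`-Lipschitz when `v` is. -/
theorem lipschitzWith_normed_convolution (φ : ContDiffBump (0 : Fin 3 → ℝ)) {v : (Fin 3 → ℝ) → F} {K : ℝ≥0}
    (hv : LipschitzWith K v) : LipschitzWith K (φ.normed volume ⋆[lsmul ℝ ℝ, volume] v) := by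
  refine LipschitzWith.of_dist_le_mul fun x y => ?_
  rw [convolution_lsmul, convolution_lsmul, dist_eq_norm,
    ← integral_sub (integrable_normed_smul_comp_sub φ hv.continuous x) (integrable_normed_smul_comp_sub φ hv.continuous y)]
  have hpt : ∀ t, ‖φ.normed volume t • v (x - t) - φ.normed volume t • v (y - t)‖ ≤ φ.normed volume t * (K * dist x y) := by
    intro t
    rw [← smul_sub, norm_smul, Real.norm_of_nonneg (φ.nonneg_normed t)]
    refine mul_le_mul_of_nonneg_left ?_ (φ.nonneg_normed t)
    have h := hv.dist_le_mul (x - t) (y - t)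
    rw [dist_eq_norm, dist_eq_norm, sub_sub_sub_cancel_right] at h
    rw [dist_eq_norm]
    exact h
  have hint : Integrable (fun t => φ.normed volume t * (K * dist x y)) := φ.integrable_normed.mul_const _
  calc ‖∫ t, φ.normed volume t • v (x - t) - φ.normed volume t • v (y - t)‖
      ≤ ∫ t, φ.normed volume t * (K * dist x y) := norm_integral_le_of_norm_le hint (Eventually.of_forall hpt)
    _ = K * dist x y := by rw [integral_mul_const, φ.integral_normed, one_mul]

/-- **Mollification moves values by at most `K·rOut`.** -/
theorem dist_normed_convolution_self_le (φ : ContDiffBump (0 : Fin 3 → ℝ)) {v : (Fin 3 → ℝ) → F} {K : ℝ≥0}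
    (hv : LipschitzWith K v) (x : Fin 3 → ℝ) :
    dist ((φ.normed volume ⋆[lsmul ℝ ℝ, volume] v) x) (v x) ≤ K * φ.rOut := by
  refine φ.dist_normed_convolution_le hv.continuous.aestronglyMeasurable fun x' hx' => ?_
  exact (hv.dist_le_mul x' x).trans (mul_le_mul_of_nonneg_left (mem_ball.1 hx').le K.2)

/-- Consequence: `‖(φ̃ ⋆ v) x‖ ≤ ‖v x‖ + K·rOut`. -/
theorem norm_normed_convolution_le (φ : ContDiffBump (0 : Fin 3 → ℝ)) {v : (Fin 3 → ℝ) → F} {K : ℝ≥0}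
    (hv : LipschitzWith K v) (x : Fin 3 → ℝ) :
    ‖(φ.normed volume ⋆[lsmul ℝ ℝ, volume] v) x‖ ≤ ‖v x‖ + K * φ.rOut := by
  have h := dist_normed_convolution_self_le φ hv x
  rw [dist_eq_norm] at h
  calc ‖(φ.normed volume ⋆[lsmul ℝ ℝ, volume] v) x‖
      = ‖((φ.normed volume ⋆[lsmul ℝ ℝ, volume] v) x - v x) + v x‖ := by rw [sub_add_cancel]
    _ ≤ ‖(φ.normed volume ⋆[lsmul ℝ ℝ, volume] v) x - v x‖ + ‖v x‖ := norm_add_le _ _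
    _ ≤ ‖v x‖ + K * φ.rOut := by linarith

/-- **Locally affine ⇒ fixed by mollification, pointwise**: if `g x = g x₀ + L (x − x₀)` on `ball x₀ r` and `ball x₁ φ.rOut ⊆ ball x₀ r`, then
`(φ̃ ⋆ g) x₁ = g x₁`. -/
theorem normed_convolution_eq_self_of_affine_near (φ : ContDiffBump (0 : Fin 3 → ℝ)) {g : (Fin 3 → ℝ) → F} {x₀ x₁ : Fin 3 → ℝ}
    {r : ℝ} (L : (Fin 3 → ℝ) →L[ℝ] F) (hg : ∀ x ∈ ball x₀ r, g x = g x₀ + L (x - x₀)) (hx₁ : ball x₁ φ.rOut ⊆ ball x₀ r) :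
    (φ.normed volume ⋆[lsmul ℝ ℝ, volume] g) x₁ = g x₁ := by
  have h1 : x₁ ∈ ball x₀ r := hx₁ (mem_ball_self φ.rOut_pos)
  refine normed_convolution_eq_right_of_affine φ L fun x hx => ?_
  rw [hg x (hx₁ hx), hg x₁ h1]
  simp only [map_sub]
  abel

/-- **Locally affine ⇒ fixed by mollification, near the point**: if `g` is affine on `ball x₀ r` with `φ.rOut < r`, then `φ̃ ⋆ g = g` eventually near `x₀`. -/
theorem normed_convolution_eventuallyEq_of_affine_near (φ : ContDiffBump (0 : Fin 3 → ℝ)) {g : (Fin 3 → ℝ) → F} {x₀ : Fin 3 → ℝ}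
    {r : ℝ} (L : (Fin 3 → ℝ) →L[ℝ] F) (hg : ∀ x ∈ ball x₀ r, g x = g x₀ + L (x - x₀)) (hr : φ.rOut < r) :
    (φ.normed volume ⋆[lsmul ℝ ℝ, volume] g) =ᶠ[𝓝 x₀] g := by
  have hnhds : ball x₀ (r - φ.rOut) ∈ 𝓝 x₀ := ball_mem_nhds x₀ (by linarith)
  filter_upwards [hnhds] with x₁ hx₁
  refine normed_convolution_eq_self_of_affine_near φ L hg fun x hx => ?_
  rw [mem_ball] at hx hx₁ ⊢
  calc dist x x₀ ≤ dist x x₁ + dist x₁ x₀ := dist_triangle _ _ _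
    _ < φ.rOut + (r - φ.rOut) := add_lt_add hx hx₁
    _ = r := by ring

/-- Hence the mollified field has the SAME derivative as `g` at `x₀`. -/
theorem fderiv_normed_convolution_eq_of_affine_near (φ : ContDiffBump (0 : Fin 3 → ℝ)) {g : (Fin 3 → ℝ) → F} {x₀ : Fin 3 → ℝ}
    {r : ℝ} (L : (Fin 3 → ℝ) →L[ℝ] F) (hg : ∀ x ∈ ball x₀ r, g x = g x₀ + L (x - x₀)) (hr : φ.rOut < r) :
    fderiv ℝ (φ.normed volume ⋆[lsmul ℝ ℝ, volume] g) x₀ = fderiv ℝ g x₀ :=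
  (normed_convolution_eventuallyEq_of_affine_near φ L hg hr).fderiv_eq

/-- … and the same value at `x₀`. -/
theorem normed_convolution_apply_eq_of_affine_near (φ : ContDiffBump (0 : Fin 3 → ℝ)) {g : (Fin 3 → ℝ) → F} {x₀ : Fin 3 → ℝ}
    {r : ℝ} (L : (Fin 3 → ℝ) →L[ℝ] F) (hg : ∀ x ∈ ball x₀ r, g x = g x₀ + L (x - x₀)) (hr : φ.rOut < r) :
    (φ.normed volume ⋆[lsmul ℝ ℝ, volume] g) x₀ = g x₀ :=
  (normed_convolution_eventuallyEq_of_affine_near φ L hg hr).eq_of_nhds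

/-- **The derivative of a `K`-Lipschitz mollified field is bounded by `K`**, entrywise in the coordinates of the far ledger:
`|∂ᵢ(φ̃ ⋆ v)ⱼ(x)| ≤ K`. -/
theorem abs_fpGrad_normed_convolution_le (φ : ContDiffBump (0 : Fin 3 → ℝ)) {v : (Fin 3 → ℝ) → (Fin 3 → ℝ)} {K : ℝ≥0}
    (hv : LipschitzWith K v) (x : Fin 3 → ℝ) (i j : Fin 3) :
    |fpGrad (φ.normed volume ⋆[lsmul ℝ ℝ, volume] v) x i j| ≤ K := by
  have hK := norm_fderiv_le_of_lipschitz ℝ (x₀ := x) (lipschitzWith_normed_convolution φ hv)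
  unfold fpGrad
  have h1 : |fderiv ℝ (φ.normed volume ⋆[lsmul ℝ ℝ, volume] v) x (fpE i) j| ≤
      ‖fderiv ℝ (φ.normed volume ⋆[lsmul ℝ ℝ, volume] v) x (fpE i)‖ := by
    rw [← Real.norm_eq_abs]; exact norm_le_pi_norm _ j
  have h2 : ‖fderiv ℝ (φ.normed volume ⋆[lsmul ℝ ℝ, volume] v) x (fpE i)‖ ≤
      ‖fderiv ℝ (φ.normed volume ⋆[lsmul ℝ ℝ, volume] v) x‖ * ‖fpE i‖ := le_opNorm _ _
  have h3 : ‖fpE i‖ = 1 := by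
    unfold fpE
    rw [Pi.norm_single, norm_one]
  rw [h3, mul_one] at h2
  exact h1.trans (h2.trans hK)

/-- The same bound for the ORIGINAL Lipschitz field (at points of differentiability it is the honest gradient; elsewhere `fderiv = 0`). -/
theorem abs_fpGrad_le_of_lipschitz {v : (Fin 3 → ℝ) → (Fin 3 → ℝ)} {K : ℝ≥0} (hv : LipschitzWith K v) (x : Fin 3 → ℝ)
    (i j : Fin 3) : |fpGrad v x i j| ≤ K := by
  have hK := norm_fderiv_le_of_lipschitz ℝ (x₀ := x) hv
  unfold fpGrad
  have h1 : |fderiv ℝ v x (fpE i) j| ≤ ‖fderiv ℝ v x (fpE i)‖ := by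
    rw [← Real.norm_eq_abs]; exact norm_le_pi_norm _ j
  have h2 : ‖fderiv ℝ v x (fpE i)‖ ≤ ‖fderiv ℝ v x‖ * ‖fpE i‖ := le_opNorm _ _
  have h3 : ‖fpE i‖ = 1 := by
    unfold fpE
    rw [Pi.norm_single, norm_one]
  rw [h3, mul_one] at h2
  exact h1.trans (h2.trans hK)

omit [NormedSpace ℝ F] [CompleteSpace F] in
/-- A `K`-Lipschitz field grows at most linearly: `‖v x‖ ≤ ‖v 0‖ + K‖x‖`. -/
theorem norm_le_of_lipschitz {v : (Fin 3 → ℝ) → F} {K : ℝ≥0} (hv : LipschitzWith K v) (x : Fin 3 → ℝ) :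
    ‖v x‖ ≤ ‖v 0‖ + K * ‖x‖ := by
  have h := hv.dist_le_mul x 0
  rw [dist_eq_norm, dist_zero_right] at h
  calc ‖v x‖ = ‖(v x - v 0) + v 0‖ := by rw [sub_add_cancel]
    _ ≤ ‖v x - v 0‖ + ‖v 0‖ := norm_add_le _ _
    _ ≤ ‖v 0‖ + K * ‖x‖ := by linarith

end Summit.AtomisticToContinuum.Crystallization.Theorems.StrictSplittingRuleBirth
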